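import Summits.QuantumAdvantage.QuantumAdvantage.Theorems.WalkFiniteStateRungDense

/-!
# Rung (G) `Coset21.TwoStepFiniteStateWalkHard 5` — part 5/6 — §8 composition from the sparse lemma, §9 (first half): free window, `WinR`, `not_winR_all_three`, lifts

VERBATIM split (for the 400-line rule) of planner qa-qnc0-p2 g22's `HOME/qa-qnc0-p2/line22/RungGCore.lean` v3 (sha16 `70defc48ef50f6ad`;
authored AND proved by the planner seat; landed by qn-prover-3 g14, ask P2-22d, `--supports stmt-QuantumAdvantage-28072`).
(+ one-line docstrings on undocumented auxiliaries, lint.)  See `WalkFiniteStateRungContraction.lean` for the planner's docstring.  WHAT THIS IS NOT: nothing about polynomial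
strategies or `LinSel`; separation NOT moved.
-/

noncomputable section

namespace Summit.QuantumAdvantage.AdviceFreeQNC0

namespace Coset21

namespace RungG

open Finset

variable {M : ℕ}

/-! ## §8 Composition from the sparse lemma alone (the other three are proved above) -/

/-- The rung for a prime `p ≥ 5`, CONDITIONAL only on the sparse-regime lemma. -/
theorem twoStepFiniteStateWalkHard_of_sparse (p : ℕ) [Fact p.Prime] (hp : 5 ≤ p) (hS : Equidist → SparseBound p) :
    TwoStepFiniteStateWalkHard p :=
  twoStepFiniteStateWalkHard_of p stub_equidist hS stub_contraction (stub_dense p hp)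

/-- The rung at `p = 5` (the signature of item stmt-QuantumAdvantage-28072), CONDITIONAL only on `Equidist → SparseBound 5`. -/
theorem twoStepFiniteStateWalkHard_five_of_sparse (hS : Equidist → SparseBound 5) : TwoStepFiniteStateWalkHard 5 :=
  haveI : Fact (Nat.Prime 5) := ⟨by norm_num⟩
  twoStepFiniteStateWalkHard_of_sparse 5 le_rfl hS


/-! ## §9 Lemma 2 + 3 (planner qa-qnc0-p2 g22): `stub_sparse : Equidist → SparseBound p`

Few active cuts `(A+1)·m ≤ n` ⇒ (pigeonhole over the `A+1` windows `[jm, jm+m)`) a window of `m` coordinates `[a, a+m)` with no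
ACTIVE cut strictly inside.  Write `u = uA ++ v ++ uB` (`glue3`, `n = a + m + q`).  On the fibre `(uA, uB)` everything the active cuts
see depends on the window only through `r = wt v (mod 3p)`: the lift `liftOf = wt uA + r + wt uB` and the path states `stateOf`
(`wtPrefix uA g` for `g ≤ a`, `wt uA + r + wtPrefix uB (g − a − m)` for `g ≥ a + m`).  The class condition fixes `r mod p`, leaving the
three residues `ℓ₀, ℓ₀ + p, ℓ₀ + 2p (mod 3p)`; passing from one to the next keeps the fired set and shifts the liveness label of a cut
`g ≤ a` by `p` and of a cut `g ≥ a+m` by `2p` (both `≢ 0 mod 3`), so by `Coset21.twistedNotAllThree` NOT all three residues win; the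
three residue counts are `2^m/(3p) · (1 ± 3p ρ^m)` by `Equidist`, whence `#win ≤ (2/3 + ε) #class` on every fibre for `m ≥ m(p, ε)`. -/

section Sparse

variable {p : ℕ} {M : ℕ}

/-- Pigeonhole: a window of `m` coordinates with no active cut strictly inside. -/
theorem exists_free_window {n : ℕ} (T : Fin (n + 1) → ZMod p → ZMod p → Bool) (w : ZMod p) {m : ℕ}
    (h : (activeCount T w + 1) * m ≤ n) :
    ∃ a : ℕ, a + m ≤ n ∧ ∀ g : Fin (n + 1), a < g.val → g.val < a + m → ¬ Active T w g := by
  classical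
  set S := (univ.filter fun g : Fin (n + 1) => Active T w g) with hS
  have hScard : S.card = activeCount T w := by
    rw [hS]; unfold activeCount; convert rfl
  set B := S.image fun g : Fin (n + 1) => (g.val - 1) / m with hB
  have hBcard : B.card < (Finset.range (activeCount T w + 1)).card := by
    rw [Finset.card_range]
    calc B.card ≤ S.card := Finset.card_image_le
      _ = activeCount T w := hScard
      _ < activeCount T w + 1 := Nat.lt_succ_self _
  obtain ⟨j, hj, hjB⟩ := Finset.exists_mem_notMem_of_card_lt_card hBcard
  rw [Finset.mem_range] at hj
  refine ⟨j * m, ?_, ?_⟩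
  · calc j * m + m = (j + 1) * m := by ring
      _ ≤ (activeCount T w + 1) * m := Nat.mul_le_mul_right m (by omega)
      _ ≤ n := h
  · intro g hg1 hg2 hA
    apply hjB
    rw [hB, Finset.mem_image]
    refine ⟨g, by rw [hS, Finset.mem_filter]; exact ⟨Finset.mem_univ _, hA⟩, ?_⟩
    exact Nat.div_eq_of_lt_le (by omega) (by rw [Nat.succ_mul]; omega)

variable {a q : ℕ}

/-- The lift (final weight mod `3p`) on the fibre `(uA, uB)` as a function of the window residue `r`. -/
def liftOf (uA : Fin a → Bool) (uB : Fin q → Bool) (r : ZMod (M + 1)) : ZMod (M + 1) :=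
  ((wt uA : ℕ) : ZMod (M + 1)) + r + ((wt uB : ℕ) : ZMod (M + 1))

/-- The path state at cut `g` on the fibre, as a function of `r` (meaningful for `g ≤ a` and `g ≥ a + m`). -/
def stateOf (m : ℕ) (uA : Fin a → Bool) (uB : Fin q → Bool) (r : ZMod (M + 1)) (g : ℕ) : ZMod (M + 1) :=
  if g ≤ a then ((wtPrefix uA g : ℕ) : ZMod (M + 1))
  else ((wt uA : ℕ) : ZMod (M + 1)) + r + ((wtPrefix uB (g - (a + m)) : ℕ) : ZMod (M + 1))

open Classical in
/-- The fibre WIN predicate as a function of the window residue `r`. -/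
def WinR (hM : M + 1 = 3 * p) (m c : ℕ) (T : Fin (a + m + q + 1) → ZMod p → ZMod p → Bool) (w : ZMod p)
    (uA : Fin a → Bool) (uB : Fin q → Bool) (r : ZMod (M + 1)) : Prop :=
  Odd ((univ.filter fun g : Fin (a + m + q + 1) =>
    Active T w g ∧ pat hM c T w (liftOf uA uB r) g (stateOf m uA uB r g.val) = true).card)

/-- Auxiliary step `liftOf_glue3` of rung (G) (planner qa-qnc0-p2, `RungGCore.lean` v3, verbatim). -/
theorem liftOf_glue3 {m : ℕ} (uA : Fin a → Bool) (v : Fin m → Bool) (uB : Fin q → Bool) :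
    ((wt (glue3 uA v uB) : ℕ) : ZMod (M + 1)) = liftOf uA uB ((wt v : ℕ) : ZMod (M + 1)) := by
  rw [wt_glue3, liftOf]; push_cast; ring

/-- Auxiliary step `stateOf_glue3` of rung (G) (planner qa-qnc0-p2, `RungGCore.lean` v3, verbatim). -/
theorem stateOf_glue3 {m : ℕ} (_hm : 0 < m) (uA : Fin a → Bool) (v : Fin m → Bool) (uB : Fin q → Bool) (g : ℕ)
    (hg : g ≤ a ∨ a + m ≤ g) :
    ((wtPrefix (glue3 uA v uB) g : ℕ) : ZMod (M + 1)) = stateOf m uA uB ((wt v : ℕ) : ZMod (M + 1)) g := by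
  unfold stateOf
  rcases hg with hg | hg
  · rw [if_pos hg, wtPrefix_glue3_of_le _ _ _ hg]
  · rw [if_neg (by omega), wtPrefix_glue3_of_ge _ _ _ hg]; push_cast; ring

/-- **Claim A**: on the fibre, WIN is `WinR` of the window residue (class condition + free window). -/
theorem ringWinU_glue3_iff_winR (hM : M + 1 = 3 * p) {m : ℕ} (hm : 0 < m) (c : ℕ)
    (T : Fin (a + m + q + 1) → ZMod p → ZMod p → Bool) (w : ZMod p)
    (hfree : ∀ g : Fin (a + m + q + 1), a < g.val → g.val < a + m → ¬ Active T w g)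
    (uA : Fin a → Bool) (v : Fin m → Bool) (uB : Fin q → Bool)
    (hcl : proj hM (((wt (glue3 uA v uB) : ℕ) : ZMod (M + 1))) = w) :
    ringWinU c (yOf T) (glue3 uA v uB) = true ↔ WinR hM m c T w uA uB ((wt v : ℕ) : ZMod (M + 1)) := by
  classical
  unfold ringWinU WinR
  rw [decide_eq_true_iff, ← Nat.odd_iff]
  have hset : (univ.filter fun g : Fin (a + m + q + 1) =>
        yOf T g (glue3 uA v uB) = true ∧ (c + g.val + walkExp (glue3 uA v uB) g.val) % 3 ≠ 0) =
      univ.filter fun g : Fin (a + m + q + 1) =>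
        Active T w g ∧ pat hM c T w (liftOf uA uB ((wt v : ℕ) : ZMod (M + 1))) g
          (stateOf m uA uB ((wt v : ℕ) : ZMod (M + 1)) g.val) = true := by
    refine Finset.filter_congr fun g _ => ?_
    rw [← pat_apply_iff hM c T w _ hcl g (glue3 uA v uB) rfl, ← liftOf_glue3]
    by_cases hA : Active T w g
    · have hg : g.val ≤ a ∨ a + m ≤ g.val := by
        by_contra hcon
        exact hfree g (by omega) (by omega) hA
      rw [stateOf_glue3 hm uA v uB g.val hg]
      simp [hA]
    · -- an inactive cut never fires
      have hT : ∀ x, T g x w = false := by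
        intro x
        cases hx : T g x w
        · rfl
        · exact absurd ⟨x, hx⟩ hA
      simp [pat, hT, hA]
  rw [hset]

/-- Casting `val` to `ZMod 3` is additive along natural-number shifts (as `3 ∣ M + 1`). -/
theorem cast3_val_add_nat (hM : M + 1 = 3 * p) (z : ZMod (M + 1)) (k : ℕ) :
    (((z + (k : ZMod (M + 1))).val : ℕ) : ZMod 3) = ((z.val : ℕ) : ZMod 3) + (k : ZMod 3) := by
  have h3 : 3 ∣ M + 1 := ⟨p, by omega⟩
  rw [ZMod.val_add, ZMod.val_natCast, ← Nat.cast_add, ZMod.natCast_eq_natCast_iff']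
  have h1 : (z.val + k % (M + 1)) % (M + 1) ≡ z.val + k % (M + 1) [MOD 3] := (Nat.mod_modEq _ (M + 1)).of_dvd h3
  have h2 : k % (M + 1) ≡ k [MOD 3] := (Nat.mod_modEq k (M + 1)).of_dvd h3
  exact h1.trans ((Nat.ModEq.refl _).add h2)

/-- **Claim B** (twisted three-charge): the three residues `r₀ + j·p`, `j = 0, 1, 2`, do not all win. -/
theorem not_winR_all_three [Fact p.Prime] (hM : M + 1 = 3 * p) (hp3 : ¬ 3 ∣ p) (m c : ℕ)
    (T : Fin (a + m + q + 1) → ZMod p → ZMod p → Bool) (w : ZMod p) (uA : Fin a → Bool) (uB : Fin q → Bool)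
    (r₀ : ZMod (M + 1)) :
    ¬ (∀ j : ℕ, j < 3 → WinR hM m c T w uA uB (r₀ + ((j * p : ℕ) : ZMod (M + 1)))) := by
  classical
  -- fired set, labels and twists at `r₀`
  set F := (univ.filter fun g : Fin (a + m + q + 1) => Active T w g ∧ T g (proj hM (stateOf m uA uB r₀ g.val)) w = true) with hF
  set s : Fin (a + m + q + 1) → ZMod 3 := fun g =>
    ((c + g.val + (liftOf uA uB r₀).val + (stateOf m uA uB r₀ g.val).val : ℕ) : ZMod 3) with hs
  set t : Fin (a + m + q + 1) → ZMod 3 := fun g => if g.val ≤ a then ((p : ℕ) : ZMod 3) else ((2 * p : ℕ) : ZMod 3) with ht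
  have hp0 : ((p : ℕ) : ZMod 3) ≠ 0 := by
    rw [Ne, ZMod.natCast_eq_zero_iff]; exact hp3
  have h2p0 : ((2 * p : ℕ) : ZMod 3) ≠ 0 := by
    rw [Ne, ZMod.natCast_eq_zero_iff]; omega
  have htne : ∀ g ∈ F, t g ≠ 0 := by
    intro g _; simp only [ht]; split_ifs; exacts [hp0, h2p0]
  have hmod : ∀ X : ℕ, (X % 3 ≠ 0) ↔ ((X : ZMod 3) ≠ 0) := fun X => by
    rw [Ne, Ne, ZMod.natCast_eq_zero_iff, Nat.dvd_iff_mod_eq_zero]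
  -- the shifted lift and states
  have hlift : ∀ j : ℕ, liftOf uA uB (r₀ + ((j * p : ℕ) : ZMod (M + 1))) = liftOf uA uB r₀ + ((j * p : ℕ) : ZMod (M + 1)) := by
    intro j; unfold liftOf; ring
  have hstate_le : ∀ (j : ℕ) (g : ℕ), g ≤ a →
      stateOf m uA uB (r₀ + ((j * p : ℕ) : ZMod (M + 1))) g = stateOf m uA uB r₀ g := by
    intro j g hg; unfold stateOf; rw [if_pos hg, if_pos hg]
  have hstate_gt : ∀ (j : ℕ) (g : ℕ), ¬ g ≤ a →
      stateOf m uA uB (r₀ + ((j * p : ℕ) : ZMod (M + 1))) g = stateOf m uA uB r₀ g + ((j * p : ℕ) : ZMod (M + 1)) := by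
    intro j g hg; unfold stateOf; rw [if_neg hg, if_neg hg]; ring
  have hprojp : ∀ j : ℕ, proj hM (((j * p : ℕ) : ZMod (M + 1))) = 0 := by
    intro j; rw [proj_natCast, Nat.cast_mul, ZMod.natCast_self, mul_zero]
  -- the set identity for each shift
  have hset : ∀ j : ℕ, (univ.filter fun g : Fin (a + m + q + 1) =>
        Active T w g ∧ pat hM c T w (liftOf uA uB (r₀ + ((j * p : ℕ) : ZMod (M + 1)))) g
          (stateOf m uA uB (r₀ + ((j * p : ℕ) : ZMod (M + 1))) g.val) = true) =
      F.filter fun g => s g + ((j : ℕ) : ZMod 3) * t g ≠ 0 := by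
    intro j
    rw [hF, Finset.filter_filter]
    refine Finset.filter_congr fun g _ => ?_
    simp only [pat, Bool.and_eq_true, decide_eq_true_eq, hs, ht]
    rw [hlift j]
    by_cases hg : g.val ≤ a
    · rw [hstate_le j g.val hg, if_pos hg, hmod]
      have hlab : ((c + g.val + (liftOf uA uB r₀ + ((j * p : ℕ) : ZMod (M + 1))).val +
            (stateOf m uA uB r₀ g.val).val : ℕ) : ZMod 3) =
          ((c + g.val + (liftOf uA uB r₀).val + (stateOf m uA uB r₀ g.val).val : ℕ) : ZMod 3) +
            ((j : ℕ) : ZMod 3) * ((p : ℕ) : ZMod 3) := by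
        have e1 := cast3_val_add_nat hM (liftOf uA uB r₀) (j * p)
        push_cast at e1 ⊢
        rw [e1]; ring
      rw [hlab]
      tauto
    · rw [hstate_gt j g.val hg, if_neg hg, map_add, hprojp j, add_zero, hmod]
      have hlab : ((c + g.val + (liftOf uA uB r₀ + ((j * p : ℕ) : ZMod (M + 1))).val +
            (stateOf m uA uB r₀ g.val + ((j * p : ℕ) : ZMod (M + 1))).val : ℕ) : ZMod 3) =
          ((c + g.val + (liftOf uA uB r₀).val + (stateOf m uA uB r₀ g.val).val : ℕ) : ZMod 3) +
            ((j : ℕ) : ZMod 3) * ((2 * p : ℕ) : ZMod 3) := by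
        have e1 := cast3_val_add_nat hM (liftOf uA uB r₀) (j * p)
        have e2 := cast3_val_add_nat hM (stateOf m uA uB r₀ g.val) (j * p)
        push_cast at e1 e2 ⊢
        rw [e1, e2]; ring
      rw [hlab]
      tauto
  -- conclude with the twisted three-charge identity
  intro hW
  apply twistedNotAllThree F s t htne
  intro k
  have hk : ((k.val : ℕ) : ZMod 3) = k := ZMod.natCast_zmod_val k
  have := hW k.val (ZMod.val_lt k)
  unfold WinR at this
  rw [hset k.val, hk] at this
  exact this

/-- Lifts of `k₀` are of the form `ℓ₀ + j·p`, `j < 3` (`ℓ₀ = k₀.val`). -/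
theorem exists_lift_eq [Fact p.Prime] (hM : M + 1 = 3 * p) (k₀ : ZMod p) (r : ZMod (M + 1)) (hr : proj hM r = k₀) :
    ∃ j : ℕ, j < 3 ∧ r = ((k₀.val : ℕ) : ZMod (M + 1)) + ((j * p : ℕ) : ZMod (M + 1)) := by
  haveI : NeZero p := ⟨(Fact.out : p.Prime).ne_zero⟩
  have hcast : ((r.val : ℕ) : ZMod (M + 1)) = r := ZMod.natCast_zmod_val r
  have hmod : r.val % p = k₀.val := by
    have h1 : proj hM ((r.val : ℕ) : ZMod (M + 1)) = k₀ := by rw [hcast, hr]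
    rw [proj_natCast] at h1
    have h2 := congrArg ZMod.val h1
    rwa [ZMod.val_natCast] at h2
  have hlt : r.val < M + 1 := ZMod.val_lt r
  refine ⟨r.val / p, ?_, ?_⟩
  · rw [Nat.div_lt_iff_lt_mul (Fact.out : p.Prime).pos]; omega
  · have h3 := Nat.mod_add_div r.val p
    rw [hmod] at h3
    conv_lhs => rw [← hcast, ← h3]
    push_cast; ring

/-- Auxiliary step `proj_lift` of rung (G) (planner qa-qnc0-p2, `RungGCore.lean` v3, verbatim). -/
theorem proj_lift [Fact p.Prime] (hM : M + 1 = 3 * p) (k₀ : ZMod p) (j : ℕ) :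
    proj hM (((k₀.val : ℕ) : ZMod (M + 1)) + ((j * p : ℕ) : ZMod (M + 1))) = k₀ := by
  rw [map_add, proj_natCast, proj_natCast, ZMod.natCast_zmod_val, Nat.cast_mul, ZMod.natCast_self, mul_zero, add_zero]

end Sparse

end RungG

end Coset21

end Summit.QuantumAdvantage.AdviceFreeQNC0
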